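import Summits.Ventures.PercRepro.C041PendantSets
import Summits.Ventures.PercRepro.C041TreeClosure
import Summits.Ventures.PercRepro.C041ZoneOCubeCountCS

/-!
# ROW C-041 — THEOREM (PENDANT ZONE): the invariant (P) propagates through every pendant attachment, hence the
one-anchor (CS) and the ZONE O-CUBE (p6, gen 29; mine-3's C-041.md §20 (b))

Setting of `C041PendantSets`: the glued zone `pendant Z₁ u Z₂ a₂` (an UNMARKED multigraph `Z₁` with anchor `a`, any
cycles; a zone `Z₂` with anchor `a₂` hung at `u`).  A state is a colouring `ω₁` of `Z₁` with a state of `Z₂`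
(`stateEquiv`), and only the status of `u` under `ω₁` matters — merged (`Mg`) or reached (`Rd`).  THE FOUR COUNTS:
`#F = mC·#F₂ + nmC·#A₂` (`card_Fset_eq`), `#T₁ = mC·#T₁₂` (`card_T1set_eq`), `#T₂ = mC·#T₂₂` (`card_T2set_eq`),
`#I = rC·#I₂ + nrC·#A₂` (`card_Iset_eq`), where `mC` / `rC` count the colourings of `Z₁` with `u` merged / reached
and `nmC` / `nrC` their complements, `#A₂ = #F₂ + #T₁₂ + #T₂₂` is the admissible count of `Z₂`; and THE
COMPLEMENTATION INVOLUTION of `Z₁`'s colouring gives `mC = rC` (`card_Mg_eq_card_Rd`).  So the 4-vector of the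
glued zone is `mC · (F₂, T₁₂, T₂₂, I₂) + nmC·#A₂ · (1, 0, 0, 1)` — a non-negative combination of `Z₂`'s 4-vector
and `(1, 0, 0, 1) ∈ 𝒦`; 𝒦 being a convex cone (`K4.add`, `K4.smul`, `C041TreeClosure`):

* **`K4_pendant`** — if `Z₂`'s counts satisfy (P) (`K4`), so do the glued zone's;
* **`zoneCSConj_pendant`**, **`zoneOCubeConj_pendant`** — hence CONJECTURE (ZONE CS) and the ZONE O-CUBE hold on the
  glued zone, anchored at `inl a`.

No cone membership of `Z₂` is needed for (P): the paper's identity `Π = x·ℓ(c) + z·Π₂ + w·n′·𝟙` is the six-vector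
form of the same four counts; (P) alone propagates.
-/

namespace PercRepro

namespace ZoneZ

namespace Pendant

open ZoneData TreeClosure Finset

universe u₁ u₂ u₃ u₄ u₅ u₆ u₇ u₈

variable {V₁ : Type u₁} {E₁ : Type u₂} {U₁ : Type u₃} {U₂ : Type u₄} {V₂ : Type u₅} {E₂ : Type u₆}
  {T₁ : Type u₇} {T₂ : Type u₈}
variable (Z₁ : ZoneData V₁ E₁ U₁ U₂) (u : V₁) (Z₂ : ZoneData V₂ E₂ T₁ T₂) (a₂ : V₂) (a : V₁)

/-! ## The states of the glued zone -/

/-- The states of the glued zone are the colourings of `Z₁` with the states of `Z₂`. -/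
def stateEquiv : State (E₁ ⊕ E₂) T₁ T₂ ≃ (E₁ → Bool) × State E₂ T₁ T₂ where
  toFun σ := (colL σ, restr σ)
  invFun p := (Sum.elim p.1 p.2.1, p.2.2)
  left_inv σ := by
    obtain ⟨c, m⟩ := σ
    refine Prod.ext ?_ rfl
    funext e
    rcases e with e | e <;> rfl
  right_inv p := by
    obtain ⟨ω, c, m⟩ := p
    rfl

/-- The equivalence, applied. -/
theorem stateEquiv_apply (σ : State (E₁ ⊕ E₂) T₁ T₂) : stateEquiv σ = (colL σ, restr σ) := rfl

/-! ## Counting colourings of `Z₁`: the complementation involution -/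

section Colourings

variable [Fintype E₁] [DecidableEq E₁]

open Classical in
/-- The colourings of `Z₁` with `u` merged into the anchor's blue sub-zone. -/
noncomputable def mgCount : ℕ := #(univ.filter fun ω : E₁ → Bool => Z₁.Mg a u ω)

open Classical in
/-- The colourings with `u` not merged. -/
noncomputable def notMgCount : ℕ := #(univ.filter fun ω : E₁ → Bool => ¬ Z₁.Mg a u ω)

open Classical in
/-- The colourings with `u` reached by the anchor's red reach. -/
noncomputable def rdCount : ℕ := #(univ.filter fun ω : E₁ → Bool => Z₁.Rd a u ω)

open Classical in
/-- The colourings with `u` not reached. -/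
noncomputable def notRdCount : ℕ := #(univ.filter fun ω : E₁ → Bool => ¬ Z₁.Rd a u ω)

/-- **Complementation**: the colourings with `u` merged are as many as those with `u` reached. -/
theorem card_Mg_eq_card_Rd : mgCount Z₁ u a = rdCount Z₁ u a := by
  classical
  unfold mgCount rdCount
  refine card_eq_of_involutive cpl cpl_cpl ?_ ?_
  · intro ω hω
    rw [Finset.mem_filter] at hω ⊢
    exact ⟨Finset.mem_univ _, (Z₁.Rd_cpl a u ω).2 hω.2⟩
  · intro ω hω
    rw [Finset.mem_filter] at hω ⊢
    exact ⟨Finset.mem_univ _, (Z₁.Mg_cpl a u ω).2 hω.2⟩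

/-- The complements agree too. -/
theorem card_notMg_eq_card_notRd : notMgCount Z₁ u a = notRdCount Z₁ u a := by
  classical
  have hm := Finset.card_filter_add_card_filter_not (s := (univ : Finset (E₁ → Bool))) fun ω => Z₁.Mg a u ω
  have hr := Finset.card_filter_add_card_filter_not (s := (univ : Finset (E₁ → Bool))) fun ω => Z₁.Rd a u ω
  have h := card_Mg_eq_card_Rd Z₁ u a
  unfold mgCount rdCount at h
  unfold notMgCount notRdCount
  omega

end Colourings

/-! ## The four counts -/

section Counts

variable [Fintype E₁] [DecidableEq E₁] [Fintype E₂] [DecidableEq E₂] [Fintype T₁] [DecidableEq T₁]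
  [Fintype T₂] [DecidableEq T₂]

/-- A filter on a product by a conjunction of conditions on the factors. -/
theorem card_filter_prod {α β : Type*} [Fintype α] [Fintype β] (P : α → Prop) (Q : β → Prop)
    [DecidablePred P] [DecidablePred Q] :
    #(univ.filter fun x : α × β => P x.1 ∧ Q x.2) = #(univ.filter P) * #(univ.filter Q) := by
  rw [← Finset.univ_product_univ, Finset.filter_product, Finset.card_product]

/-- A filter on the states of the glued zone, as a filter on pairs. -/
theorem card_filter_eq (Q : State (E₁ ⊕ E₂) T₁ T₂ → Prop) (Q' : (E₁ → Bool) × State E₂ T₁ T₂ → Prop)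
    [DecidablePred Q] [DecidablePred Q'] (h : ∀ σ, Q σ ↔ Q' (colL σ, restr σ)) :
    #(univ.filter Q) = #(univ.filter Q') := by
  refine Finset.card_equiv stateEquiv fun σ => ?_
  rw [Finset.mem_filter, Finset.mem_filter]
  simp only [Finset.mem_univ, true_and, stateEquiv_apply]
  exact h σ

/-- **`#F = mC·#F₂ + nmC·#A₂`**. -/
theorem card_Fset_eq :
    #((pendant Z₁ u Z₂ a₂).Fset (Sum.inl a)) =
      mgCount Z₁ u a * #(Z₂.Fset a₂) + notMgCount Z₁ u a * #(Z₂.Aset (∅ : Set V₂)) := by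
  classical
  have e := card_filter_eq (E₁ := E₁) (E₂ := E₂) (T₁ := T₁) (T₂ := T₂)
    (fun σ => (pendant Z₁ u Z₂ a₂).adm σ ∧ Sum.inl a ∉ (pendant Z₁ u Z₂ a₂).D σ ∧
      Sum.inl a ∉ (pendant Z₁ u Z₂ a₂).D2 σ)
    (fun p => Z₂.adm p.2 ∧ ¬ (a₂ ∈ Z₂.D p.2 ∧ Z₁.Mg a u p.1) ∧ ¬ (a₂ ∈ Z₂.D2 p.2 ∧ Z₁.Mg a u p.1))
    (fun σ => by rw [adm_iff, inl_a_mem_D_iff, inl_a_mem_D2_iff])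
  have hF : (pendant Z₁ u Z₂ a₂).Fset (Sum.inl a) = univ.filter fun σ => (pendant Z₁ u Z₂ a₂).adm σ ∧
      Sum.inl a ∉ (pendant Z₁ u Z₂ a₂).D σ ∧ Sum.inl a ∉ (pendant Z₁ u Z₂ a₂).D2 σ := by
    ext σ
    rw [mem_Fset, Finset.mem_filter]
    simp only [Finset.mem_univ, true_and]
  rw [hF, e]
  have hsplit := Finset.card_filter_add_card_filter_not
    (s := (univ : Finset ((E₁ → Bool) × State E₂ T₁ T₂)).filter fun p =>
      Z₂.adm p.2 ∧ ¬ (a₂ ∈ Z₂.D p.2 ∧ Z₁.Mg a u p.1) ∧ ¬ (a₂ ∈ Z₂.D2 p.2 ∧ Z₁.Mg a u p.1))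
    fun p => Z₁.Mg a u p.1
  have e1 : ((univ : Finset ((E₁ → Bool) × State E₂ T₁ T₂)).filter fun p =>
      Z₂.adm p.2 ∧ ¬ (a₂ ∈ Z₂.D p.2 ∧ Z₁.Mg a u p.1) ∧ ¬ (a₂ ∈ Z₂.D2 p.2 ∧ Z₁.Mg a u p.1)).filter
      (fun p => Z₁.Mg a u p.1) =
      univ.filter fun p : (E₁ → Bool) × State E₂ T₁ T₂ =>
        Z₁.Mg a u p.1 ∧ (Z₂.adm p.2 ∧ a₂ ∉ Z₂.D p.2 ∧ a₂ ∉ Z₂.D2 p.2) := by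
    ext p
    simp only [Finset.mem_filter, Finset.mem_univ, true_and]
    tauto
  have e2 : ((univ : Finset ((E₁ → Bool) × State E₂ T₁ T₂)).filter fun p =>
      Z₂.adm p.2 ∧ ¬ (a₂ ∈ Z₂.D p.2 ∧ Z₁.Mg a u p.1) ∧ ¬ (a₂ ∈ Z₂.D2 p.2 ∧ Z₁.Mg a u p.1)).filter
      (fun p => ¬ Z₁.Mg a u p.1) =
      univ.filter fun p : (E₁ → Bool) × State E₂ T₁ T₂ => ¬ Z₁.Mg a u p.1 ∧ Z₂.adm p.2 := by
    ext p
    simp only [Finset.mem_filter, Finset.mem_univ, true_and]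
    tauto
  rw [e1, e2, card_filter_prod (fun ω => Z₁.Mg a u ω) (fun τ => Z₂.adm τ ∧ a₂ ∉ Z₂.D τ ∧ a₂ ∉ Z₂.D2 τ),
    card_filter_prod (fun ω => ¬ Z₁.Mg a u ω) (fun τ => Z₂.adm τ)] at hsplit
  have hF₂ : Z₂.Fset a₂ = univ.filter fun τ => Z₂.adm τ ∧ a₂ ∉ Z₂.D τ ∧ a₂ ∉ Z₂.D2 τ := by
    ext τ
    rw [mem_Fset, Finset.mem_filter]
    simp only [Finset.mem_univ, true_and]
  have hA₂ : Z₂.Aset (∅ : Set V₂) = univ.filter fun τ => Z₂.adm τ := by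
    ext τ
    rw [mem_Aset_empty, Finset.mem_filter]
    simp only [Finset.mem_univ, true_and]
  rw [hF₂, hA₂]
  unfold mgCount notMgCount
  omega

/-- **`#T₁ = mC·#T₁₂`**. -/
theorem card_T1set_eq :
    #((pendant Z₁ u Z₂ a₂).T1set (Sum.inl a)) = mgCount Z₁ u a * #(Z₂.T1set a₂) := by
  classical
  have e := card_filter_eq (E₁ := E₁) (E₂ := E₂) (T₁ := T₁) (T₂ := T₂)
    (fun σ => (pendant Z₁ u Z₂ a₂).adm σ ∧ Sum.inl a ∈ (pendant Z₁ u Z₂ a₂).D σ)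
    (fun p => Z₁.Mg a u p.1 ∧ (Z₂.adm p.2 ∧ a₂ ∈ Z₂.D p.2))
    (fun σ => by rw [adm_iff, inl_a_mem_D_iff]; tauto)
  have hT : (pendant Z₁ u Z₂ a₂).T1set (Sum.inl a) = univ.filter fun σ => (pendant Z₁ u Z₂ a₂).adm σ ∧
      Sum.inl a ∈ (pendant Z₁ u Z₂ a₂).D σ := by
    ext σ
    rw [mem_T1set, Finset.mem_filter]
    simp only [Finset.mem_univ, true_and]
  have hT₂ : Z₂.T1set a₂ = univ.filter fun τ => Z₂.adm τ ∧ a₂ ∈ Z₂.D τ := by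
    ext τ
    rw [mem_T1set, Finset.mem_filter]
    simp only [Finset.mem_univ, true_and]
  rw [hT, e, card_filter_prod (fun ω => Z₁.Mg a u ω) (fun τ => Z₂.adm τ ∧ a₂ ∈ Z₂.D τ), hT₂]
  rfl

/-- **`#T₂ = mC·#T₂₂`**. -/
theorem card_T2set_eq :
    #((pendant Z₁ u Z₂ a₂).T2set (Sum.inl a)) = mgCount Z₁ u a * #(Z₂.T2set a₂) := by
  classical
  have e := card_filter_eq (E₁ := E₁) (E₂ := E₂) (T₁ := T₁) (T₂ := T₂)
    (fun σ => (pendant Z₁ u Z₂ a₂).adm σ ∧ Sum.inl a ∈ (pendant Z₁ u Z₂ a₂).D2 σ)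
    (fun p => Z₁.Mg a u p.1 ∧ (Z₂.adm p.2 ∧ a₂ ∈ Z₂.D2 p.2))
    (fun σ => by rw [adm_iff, inl_a_mem_D2_iff]; tauto)
  have hT : (pendant Z₁ u Z₂ a₂).T2set (Sum.inl a) = univ.filter fun σ => (pendant Z₁ u Z₂ a₂).adm σ ∧
      Sum.inl a ∈ (pendant Z₁ u Z₂ a₂).D2 σ := by
    ext σ
    rw [mem_T2set, Finset.mem_filter]
    simp only [Finset.mem_univ, true_and]
  have hT₂ : Z₂.T2set a₂ = univ.filter fun τ => Z₂.adm τ ∧ a₂ ∈ Z₂.D2 τ := by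
    ext τ
    rw [mem_T2set, Finset.mem_filter]
    simp only [Finset.mem_univ, true_and]
  rw [hT, e, card_filter_prod (fun ω => Z₁.Mg a u ω) (fun τ => Z₂.adm τ ∧ a₂ ∈ Z₂.D2 τ), hT₂]
  rfl

/-- **`#I = rC·#I₂ + nrC·#A₂`**. -/
theorem card_Iset_eq :
    #((pendant Z₁ u Z₂ a₂).Iset (Sum.inl a)) =
      rdCount Z₁ u a * #(Z₂.Iset a₂) + notRdCount Z₁ u a * #(Z₂.Aset (∅ : Set V₂)) := by
  classical
  have e := card_filter_eq (E₁ := E₁) (E₂ := E₂) (T₁ := T₁) (T₂ := T₂)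
    (fun σ => (pendant Z₁ u Z₂ a₂).adm σ ∧ (pendant Z₁ u Z₂ a₂).blueK {Sum.inl a} σ)
    (fun p => Z₂.adm p.2 ∧ (Z₁.Rd a u p.1 → Z₂.blueK {a₂} p.2))
    (fun σ => by rw [adm_iff, blueK_iff])
  have hI : (pendant Z₁ u Z₂ a₂).Iset (Sum.inl a) = univ.filter fun σ => (pendant Z₁ u Z₂ a₂).adm σ ∧
      (pendant Z₁ u Z₂ a₂).blueK {Sum.inl a} σ := by
    ext σ
    rw [mem_Iset, Finset.mem_filter]
    simp only [Finset.mem_univ, true_and]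
  rw [hI, e]
  have hsplit := Finset.card_filter_add_card_filter_not
    (s := (univ : Finset ((E₁ → Bool) × State E₂ T₁ T₂)).filter fun p =>
      Z₂.adm p.2 ∧ (Z₁.Rd a u p.1 → Z₂.blueK {a₂} p.2))
    fun p => Z₁.Rd a u p.1
  have e1 : ((univ : Finset ((E₁ → Bool) × State E₂ T₁ T₂)).filter fun p =>
      Z₂.adm p.2 ∧ (Z₁.Rd a u p.1 → Z₂.blueK {a₂} p.2)).filter (fun p => Z₁.Rd a u p.1) =
      univ.filter fun p : (E₁ → Bool) × State E₂ T₁ T₂ => Z₁.Rd a u p.1 ∧ (Z₂.adm p.2 ∧ Z₂.blueK {a₂} p.2) := by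
    ext p
    simp only [Finset.mem_filter, Finset.mem_univ, true_and]
    tauto
  have e2 : ((univ : Finset ((E₁ → Bool) × State E₂ T₁ T₂)).filter fun p =>
      Z₂.adm p.2 ∧ (Z₁.Rd a u p.1 → Z₂.blueK {a₂} p.2)).filter (fun p => ¬ Z₁.Rd a u p.1) =
      univ.filter fun p : (E₁ → Bool) × State E₂ T₁ T₂ => ¬ Z₁.Rd a u p.1 ∧ Z₂.adm p.2 := by
    ext p
    simp only [Finset.mem_filter, Finset.mem_univ, true_and]
    tauto
  rw [e1, e2, card_filter_prod (fun ω => Z₁.Rd a u ω) (fun τ => Z₂.adm τ ∧ Z₂.blueK {a₂} τ),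
    card_filter_prod (fun ω => ¬ Z₁.Rd a u ω) (fun τ => Z₂.adm τ)] at hsplit
  have hI₂ : Z₂.Iset a₂ = univ.filter fun τ => Z₂.adm τ ∧ Z₂.blueK {a₂} τ := by
    ext τ
    rw [mem_Iset, Finset.mem_filter]
    simp only [Finset.mem_univ, true_and]
  have hA₂ : Z₂.Aset (∅ : Set V₂) = univ.filter fun τ => Z₂.adm τ := by
    ext τ
    rw [mem_Aset_empty, Finset.mem_filter]
    simp only [Finset.mem_univ, true_and]
  rw [hI₂, hA₂]
  unfold rdCount notRdCount
  omega

/-! ## THEOREM (PENDANT ZONE) -/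

/-- `(1, 0, 0, 1)` lies in 𝒦. -/
theorem K4_one_zero_zero_one : K4 (1 : ℝ) 0 0 1 where
  t1_nonneg := le_rfl
  t2_nonneg := le_rfl
  k_nonneg := zero_le_one
  k_le_g := le_rfl
  cs := by norm_num

/-- **THEOREM (PENDANT ZONE), (P)-propagation form** (C-041.md §20 (b)): if the counts of `Z₂` at its anchor
satisfy the invariant (P), so do the counts of the glued zone at the anchor of `Z₁`. -/
theorem K4_pendant (h : K4 (#(Z₂.Fset a₂) : ℝ) (#(Z₂.T1set a₂)) (#(Z₂.T2set a₂)) (#(Z₂.Iset a₂))) :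
    K4 (#((pendant Z₁ u Z₂ a₂).Fset (Sum.inl a)) : ℝ) (#((pendant Z₁ u Z₂ a₂).T1set (Sum.inl a)))
      (#((pendant Z₁ u Z₂ a₂).T2set (Sum.inl a))) (#((pendant Z₁ u Z₂ a₂).Iset (Sum.inl a))) := by
  have hmC : (0 : ℝ) ≤ mgCount Z₁ u a := Nat.cast_nonneg _
  have hnN : (0 : ℝ) ≤ (notMgCount Z₁ u a : ℝ) * #(Z₂.Aset (∅ : Set V₂)) :=
    mul_nonneg (Nat.cast_nonneg _) (Nat.cast_nonneg _)
  have hK := K4.add (h.smul hmC) (K4_one_zero_zero_one.smul hnN)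
  have eF : (#((pendant Z₁ u Z₂ a₂).Fset (Sum.inl a)) : ℝ) =
      mgCount Z₁ u a * #(Z₂.Fset a₂) + (notMgCount Z₁ u a : ℝ) * #(Z₂.Aset (∅ : Set V₂)) * 1 := by
    rw [card_Fset_eq]
    push_cast
    ring
  have eT1 : (#((pendant Z₁ u Z₂ a₂).T1set (Sum.inl a)) : ℝ) =
      mgCount Z₁ u a * #(Z₂.T1set a₂) + (notMgCount Z₁ u a : ℝ) * #(Z₂.Aset (∅ : Set V₂)) * 0 := by
    rw [card_T1set_eq]
    push_cast
    ring
  have eT2 : (#((pendant Z₁ u Z₂ a₂).T2set (Sum.inl a)) : ℝ) =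
      mgCount Z₁ u a * #(Z₂.T2set a₂) + (notMgCount Z₁ u a : ℝ) * #(Z₂.Aset (∅ : Set V₂)) * 0 := by
    rw [card_T2set_eq]
    push_cast
    ring
  have eI : (#((pendant Z₁ u Z₂ a₂).Iset (Sum.inl a)) : ℝ) =
      mgCount Z₁ u a * #(Z₂.Iset a₂) + (notMgCount Z₁ u a : ℝ) * #(Z₂.Aset (∅ : Set V₂)) * 1 := by
    rw [card_Iset_eq, ← card_Mg_eq_card_Rd, ← card_notMg_eq_card_notRd]
    push_cast
    ring
  rw [eF, eT1, eT2, eI]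
  exact hK

/-- The invalid states of the glued zone are at most its all-red ones. -/
theorem card_Iset_le_card_Fset_pendant
    (h : K4 (#(Z₂.Fset a₂) : ℝ) (#(Z₂.T1set a₂)) (#(Z₂.T2set a₂)) (#(Z₂.Iset a₂))) :
    #((pendant Z₁ u Z₂ a₂).Iset (Sum.inl a)) ≤ #((pendant Z₁ u Z₂ a₂).Fset (Sum.inl a)) := by
  exact_mod_cast (K4_pendant Z₁ u Z₂ a₂ a h).k_le_g

/-- **THEOREM (PENDANT ZONE), (CS) form**: CONJECTURE (ZONE CS) holds on the glued zone, anchored at `inl a`, as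
soon as `Z₂`'s counts satisfy (P). -/
theorem zoneCSConj_pendant (h : K4 (#(Z₂.Fset a₂) : ℝ) (#(Z₂.T1set a₂)) (#(Z₂.T2set a₂)) (#(Z₂.Iset a₂))) :
    (pendant Z₁ u Z₂ a₂).ZoneCSConj {Sum.inl a} (∅ : Set (V₁ ⊕ V₂)) := by
  rw [zoneCSConj_single_iff]
  have hcs := (K4_pendant Z₁ u Z₂ a₂ a h).cs
  have hle := card_Iset_le_card_Fset_pendant Z₁ u Z₂ a₂ a h
  have h2 : (((#((pendant Z₁ u Z₂ a₂).Fset (Sum.inl a)) - #((pendant Z₁ u Z₂ a₂).Iset (Sum.inl a)) : ℕ) : ℝ)) ^ 2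
      ≤ ((#((pendant Z₁ u Z₂ a₂).T1set (Sum.inl a)) * #((pendant Z₁ u Z₂ a₂).T2set (Sum.inl a)) : ℕ) : ℝ) := by
    rw [Nat.cast_sub hle]
    push_cast
    exact hcs
  exact_mod_cast h2

/-- **THEOREM (PENDANT ZONE), O-cube form**: the ZONE O-CUBE holds on the glued zone. -/
theorem zoneOCubeConj_pendant (h : K4 (#(Z₂.Fset a₂) : ℝ) (#(Z₂.T1set a₂)) (#(Z₂.T2set a₂)) (#(Z₂.Iset a₂))) :
    (pendant Z₁ u Z₂ a₂).ZoneOCubeConj {Sum.inl a} (∅ : Set (V₁ ⊕ V₂)) :=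
  zoneOCubeConj_of_zoneCS _ _ _ (zoneCSConj_pendant Z₁ u Z₂ a₂ a h)

end Counts

end Pendant

end ZoneZ

end PercRepro
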